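import Summits.BirchSwinnertonDyer.BirchSwinnertonDyer.Theorems.GenusKolyvaginAtTwoVisiblePairAtTwoCasselsTateLocalInjective
import Summits.BirchSwinnertonDyer.BirchSwinnertonDyer.Theorems.GenusKolyvaginAtTwoVisiblePairAtTwoCasselsTatePullback
import Literature.NumberTheory.EllipticCurves.CasselsTateSelmerKolyvaginValue
import Literature.NumberTheory.EllipticCurves.CasselsTateFiniteSupport
import HarnessLib

/-!
# Route `GenusKolyvaginAtTwo`, crux `KolyvaginExactAtTwo` (22137) → Q3-inner: McCallum's Prop. 4.7 for the
# member `E` of the `ℚ`-pair — the Cassels–Tate value on a Kolyvagin pair is the LOCAL TERM at `λ`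

Seat `bsd-line-gk2-p2` g12 (cell `bsd-f1-sign2`). THEOREMS ONLY (no definition, no named fact, no `sorry`).

For the first member `E = W/ℚ` of the visible pair at level `2^M`, `M = L + L`, and the level-`2^L` Cassels–Tate
pairing `B₁ = ctLevelPairing W (2^L) …` (Milne's Prop. 6.9 recipe; auxiliary level `2^L · 2^L = 2^M`) pulled back
to `Sel_{2^M}(E/ℚ)` along `ι₁` (`…CasselsTatePullback`), the VALUE FORMULA `hV₁` of
`Literature.….VisiblePairHypothesesM.hCTV_of_members` (McCallum Prop. 4.7 + Lemma 5.3 in order language, restricted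
to `2^{2M₀}`-torsion classes) is REDUCED to its purely local residue at `λ = v_ℓ`:
`hloc₁ : D.localTerm … (v_ℓ) ≠ 0` for the first-case data `D` of the pair `(2^j c₁(ℓm'), t)` (McCallum's
Lemma 5.3 in the tree's cochain currency — displayed, as in the odd-`p` file
`HeegnerPointsKolyvaginPrimaryOrderHCTVProofs`). The reduction: transport to the level `2^L · 2^L`
(`torsionH1OfDvd`, the two levels being equal), the tree's `ctLevelPairing_pullback_ne_zero_iff_localTerm`
(`CasselsTateSelmerLocalValue`), and at every place `v ≠ v_ℓ` either Lemma 4.3 over `ℚ` for `c₁(ℓm')`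
(`Input.loc_c₁_fin/inf`: `v ∤ ℓm'`, incl. `∞`, `2`, the bad places) or, at the places of `m'`, `loc_v t = 0`
(`t ∈ a₁ q`) together with the injectivity of `ι_*` over `ℚ_q` (`…CasselsTateLocalInjective`, by counting — the
`ℚ_q` substitute for `E[p^{M+M'}] ⊆ E(K_λ)`); `[2^L]_* t' = 0` since `2^{2M₀} t = 0`, `2M₀ ≤ L` and
`E(ℚ) ∩ E[2^L] = 0` (`ρ̄_{E,2}` onto).

BSD is not proved by any of this.

References: [McCallumLMS1991] §2 (1), §4 Lemma 4.3, Prop. 4.7, §5 Lemma 5.3, Thm. 5.4 (proof);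
[MilneADT2006] I §6 Prop. 6.9; [SerreGaloisCohomology1997] I §2.2.
-/

set_option linter.dupNamespace false -- tree convention: `Summit.BirchSwinnertonDyer.BirchSwinnertonDyer.Theorems` (summit = sub-problem)
set_option autoImplicit false

noncomputable section

open scoped Classical
open scoped AddSubgroup

universe u

namespace Summit.BirchSwinnertonDyer.BirchSwinnertonDyer.Theorems.GenusExact.VisiblePairAtTwo

open WeierstrassCurve NumberField IsDedekindDomain Field Function Rat.HeightOneSpectrum
open Literature.NumberTheory.EllipticCurves Literature.NumberTheory.GaloisRepresentations
open Literature.NumberTheory.GaloisCohomology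
open Literature.NumberTheory.GaloisRepresentations.DiscreteGaloisModule (mu)
open Literature.NumberTheory.EllipticCurves.KolyvaginDescent
open Literature.GroupTheory.FiniteAbelian

/-! ## §1. Plumbing: the two equal levels `2^{L+L}` and `2^L · 2^L`; no rational `2`-power torsion -/

/-- `2^{L+L} ∣ 2^L · 2^L` (the two levels are equal). [folklore] -/
theorem lvl_dvd_sq (L : ℕ) : (lvl (L + L) : ℤ) ∣ ((2 ^ L * 2 ^ L : ℕ) : ℤ) := by
  rw [← pow_add]

/-- `(2^L : ℤ) · 2^{j-L} = 2^j` bookkeeping: `τ(2^j c) = 2^L · τ(2^{j-L} c)` for `L ≤ j`. [folklore] -/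
theorem zsmul_pow_sub_eq {A : Type*} [AddCommGroup A] {L j : ℕ} (hLj : L ≤ j) (c : A) :
    ((2 ^ L : ℕ) : ℤ) • ((2 : ℤ) ^ (j - L)) • c = ((2 : ℤ) ^ j) • c := by
  rw [smul_smul, Nat.cast_pow, Nat.cast_ofNat, ← pow_add, Nat.add_sub_cancel' hLj]

section NoTorsion

variable {F : Type u} [Field F] [NumberField F] (A : WeierstrassCurve F) [A.IsElliptic]

omit [NumberField F] [A.IsElliptic] in
/-- **No non-zero `Γ_F`-fixed point in `E[2^L]` when `E(F)[2] = 0`** (a fixed geometric torsion point is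
rational, and `E(F)` has no `2`-power torsion). [cite: SilvermanAEC2009, VIII.§1] -/
theorem geomTorsion_fixed_eq_zero_of_forall_two_nsmul [PerfectField F] (h2 : ∀ P : A.toAffine.Point, 2 • P = 0 → P = 0) (L : ℕ)
    (P : geomTorsion A ((2 ^ L : ℕ) : ℤ)) (hP : ∀ σ : absoluteGaloisGroup F, σ • P = P) : P = 0 := by
  have h2' : ∀ Q : A.toAffine.Point, (2 : ℤ) • Q = 0 → Q = 0 := fun Q hQ ↦
    h2 Q (by rw [← natCast_zsmul]; exact hQ)
  have hfix : (P : geomPoints A) ∈ MulAction.fixedPoints (absoluteGaloisGroup F) (geomPoints A) := fun σ ↦ by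
    rw [← Literature.NumberTheory.EllipticCurves.AddSubgroup.torsionBy.coe_smul, hP σ]
  obtain ⟨Q, hQ⟩ := (mem_range_toGeomPoints_iff A _).mpr hfix
  have hQ0 : ((2 : ℤ) ^ L) • Q = 0 := by
    apply toGeomPoints_injective A
    rw [map_zsmul, hQ, map_zero, ← Nat.cast_ofNat, ← Nat.cast_pow]
    exact (mem_geomTorsion_iff A _ _).mp P.2
  have hQ' : Q = 0 := eq_zero_of_pow_zsmul_eq_zero h2' L Q hQ0
  apply Subtype.ext
  rw [ZeroMemClass.coe_zero, ← hQ, hQ', map_zero]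

end NoTorsion

/-! ## §2. The value formula for the member `E`, from the local term at `λ` -/

section MemberOne

variable {W : WeierstrassCurve ℚ} [W.IsElliptic] [W.IsGloballyMinimal] {K : Type} [Field K] [NumberField K]
  {L : ℕ} {θ : K} {hθ : θ ∉ Set.range (algebraMap ℚ K)}
  {hθsq : θ ^ 2 = algebraMap ℚ K ((NumberField.discr K : ℤ) : ℚ)} [(twin W K).IsElliptic]

/-- **McCallum's Prop. 4.7 for the member `E` of the `ℚ`-pair at `2`: the value formula `hV₁` of
`VisiblePairHypothesesM.hCTV_of_members` for the pulled-back level-`2^L` Cassels–Tate pairing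
`P₁(z, t) = B₁(ι₁ z, ι₁ t)`, `B₁ = ctLevelPairing W (2^L)`, FROM the local term at `λ`.** For a Kolyvagin prime
`ℓ`, `n = ℓm'` of even depth, `z = 2^j c₁(ℓm') ∈ Sel_{2^M}(E/ℚ)` (`M = L + L`, `M − M₀ ≤ j`), a Selmer class `t`
with `2^{2M₀} t = 0` (`2M₀ ≤ L`) vanishing at the primes of `m'`: `P₁(z, t) ≠ 0` as soon as the local term at
`v_ℓ` of (every) first-case data of the transported pair is non-zero (`hloc₁`, McCallum's Lemma 5.3). All other
local terms vanish: at `v ∤ ℓm'` (finite or infinite) by Lemma 4.3 over `ℚ` (`Input.loc_c₁_fin/inf`), at the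
places of `m'` by `t ∈ a₁ q` and the injectivity of `ι_*` over `ℚ_q` (`map_inclKD_restrictField_injective_of_kolPrime`).
[cite: McCallumLMS1991, §4 Prop. 4.7, §5 Lemma 5.3, Thm. 5.4 (proof)] [cite: MilneADT2006, Ch. I §6, Prop. 6.9] -/
theorem hV₁_of_localTerm (I : Input W K (L + L) hθ hθsq) (hρ2 : W.HasSurjectiveModNGaloisRep 2)
    (hx : torsionH1ToH1 W (lvl (L + L)) I.x = 0) (hL : 2 * I.M₀ ≤ L)
    -- the Cassels–Tate data for `W` at level `2^L`, auxiliary level `2^L · 2^L`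
    (e : geomTorsion W ((2 ^ L * 2 ^ L : ℕ) : ℤ) → geomTorsion W ((2 ^ L * 2 ^ L : ℕ) : ℤ) → AlgebraicClosure ℚ)
    (hμ : ∀ S T, e S T ^ (2 ^ L * 2 ^ L) = 1)
    (hadd₁ : ∀ S₁ S₂ T, e (S₁ + S₂) T = e S₁ T * e S₂ T)
    (hadd₂ : ∀ S T₁ T₂, e S (T₁ + T₂) = e S T₁ * e S T₂)
    (hgal : ∀ (σ : absoluteGaloisGroup ℚ) (S T : geomTorsion W ((2 ^ L * 2 ^ L : ℕ) : ℤ)),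
      σ • e S T = e (σ • S) (σ • T))
    (halt : ∀ T, e T T = 1) (inv : LocalInvariants ℚ (2 ^ L * 2 ^ L)) (hPT' : inv.SumInvLocalizationEqZero)
    (hH3 : ∀ c : galoisCohomology (mu ℚ (2 ^ L * 2 ^ L)) 3,
      (∀ v : Place ℚ, galoisCohomology.localization (mu ℚ (2 ^ L * 2 ^ L)) v 3 c = 0) → c = 0)
    (ι₁ : selmerGroup W (lvl (L + L)) →+ (W.sha)[(2 ^ L : ℕ)])
    (hι₁ : ∀ z, shaTorsionVal W (2 ^ L) (ι₁ z) = torsionH1ToH1 W (lvl (L + L)) z)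
    -- McCallum's Lemma 5.3 for the local term at `λ`, in the tree's cochain currency (displayed)
    (hloc₁ : ∀ ℓ m' : ℕ, (hℓ : kolPrime W K (L + L) ℓ) → KolSupp (kolPrime W K (L + L)) (ℓ * m') → ¬ ℓ ∣ m' →
      Odd m'.primeFactors.card →
      ∀ (j N a b : ℕ) (t : galH1Torsion W (lvl (L + L))), t ∈ selmerGroup W (lvl (L + L)) →
      ((2 : ℤ) ^ j) • I.c₁ (ℓ * m') ∈ selmerGroup W (lvl (L + L)) →
      ((2 : ℤ) ^ N) • t = 0 → ((2 : ℤ) ^ (2 * I.M₀)) • t = 0 →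
      (∀ q ∈ m'.primeFactors, t ∈ a₁ W (L + L) q) → L + L - I.M₀ ≤ j → N + I.M₀ ≤ L + L → N ≤ j →
      a + b + 1 = N → ((2 : ℤ) ^ (a + (j - N))) • I.c₂ m' ∉ a₂ W K (L + L) ℓ →
      ((2 : ℤ) ^ b) • t ∉ a₁ W (L + L) ℓ →
      ∀ D : FirstCaseData W (2 ^ L),
        D.b₁ = torsionH1OfDvd W (lvl_dvd_sq L) (((2 : ℤ) ^ (j - L)) • I.c₁ (ℓ * m')) →
        galoisCohomology.map (inclKD W (2 ^ L) (2 ^ L)) 1 D.b' = torsionH1OfDvd W (lvl_dvd_sq L) t →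
        D.localTerm e hμ hadd₁ hadd₂ hgal inv (Sum.inr (primesEquiv.symm ⟨ℓ, hℓ.1⟩)) ≠ 0) :
    ∀ ℓ m' : ℕ, (visiblePair I).Kol ℓ → KolSupp (visiblePair I).Kol (ℓ * m') → ¬ ℓ ∣ m' →
      Odd m'.primeFactors.card →
      ∀ (j N a b : ℕ) (t : galH1Torsion W (lvl (L + L))) (ht : t ∈ (visiblePair I).Sel₁)
        (hz : (((visiblePair I).p : ℤ) ^ j) • (visiblePair I).c₁ (ℓ * m') ∈ (visiblePair I).Sel₁),
      (((visiblePair I).p : ℤ) ^ N) • t = 0 → (((visiblePair I).p : ℤ) ^ (2 * (visiblePair I).M₀)) • t = 0 →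
      (∀ q ∈ m'.primeFactors, t ∈ (visiblePair I).A₁ q) → (visiblePair I).M - (visiblePair I).M₀ ≤ j →
      N + (visiblePair I).M₀ ≤ (visiblePair I).M → N ≤ j → a + b + 1 = N →
      (((visiblePair I).p : ℤ) ^ (a + (j - N))) • (visiblePair I).c₂ m' ∉ (visiblePair I).A₂ ℓ →
      (((visiblePair I).p : ℤ) ^ b) • t ∉ (visiblePair I).A₁ ℓ →
      ((ctLevelPairing W (2 ^ L) e hμ hadd₁ hadd₂ hgal inv halt hPT' hH3
        (localTerm_finite_support (W := W) (m := 2 ^ L) (e := e) (hμ := hμ) (hadd₁ := hadd₁) (hadd₂ := hadd₂)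
          (hgal := hgal) halt inv)).comp ι₁).compl₂ ι₁ ⟨_, hz⟩ ⟨t, ht⟩ ≠ 0 := by
  intro ℓ m' hℓ hsupp hndvd hodd j N a b t ht hz hN h2 hAq hj hNM hNj hab hcm hbt
  -- read the instance's fields (`(visiblePair I).p = 2`, `.M = L + L`, `.M₀ = I.M₀`, `.c₁ = I.c₁`, …)
  change kolPrime W K (L + L) ℓ at hℓ
  change KolSupp (kolPrime W K (L + L)) (ℓ * m') at hsupp
  have ht2 : t ∈ selmerGroup W (lvl (L + L)) := ht
  have hz2 : ((2 : ℤ) ^ j) • I.c₁ (ℓ * m') ∈ selmerGroup W (lvl (L + L)) := hz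
  have hN2 : ((2 : ℤ) ^ N) • t = 0 := hN
  have h22 : ((2 : ℤ) ^ (2 * I.M₀)) • t = 0 := h2
  have hAq2 : ∀ q ∈ m'.primeFactors, t ∈ a₁ W (L + L) q := hAq
  have hj2 : L + L - I.M₀ ≤ j := hj
  have hNM2 : N + I.M₀ ≤ L + L := hNM
  have hcm2 : ((2 : ℤ) ^ (a + (j - N))) • I.c₂ m' ∉ a₂ W K (L + L) ℓ := hcm
  have hbt2 : ((2 : ℤ) ^ b) • t ∉ a₁ W (L + L) ℓ := hbt
  have hℓp : ℓ.Prime := hℓ.1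
  haveI : NeZero (2 ^ L) := ⟨pow_ne_zero L two_ne_zero⟩
  have hΔ : W.Δ < 0 := I.hΔ
  have hjL : L ≤ j := by omega
  have heven : Even (ℓ * m').primeFactors.card := by
    have hmem : ℓ ∈ (ℓ * m').primeFactors :=
      Nat.mem_primeFactors.mpr ⟨hℓp, dvd_mul_right ℓ m', hsupp.1.ne_zero⟩
    obtain ⟨-, -, -, -, -, -, -, hcard⟩ := kolSupp_div hsupp hmem
    rw [Nat.mul_div_cancel_left m' hℓp.pos] at hcard
    rw [← hcard]; exact hodd.add_one
  set v₀ : HeightOneSpectrum (𝓞 ℚ) := primesEquiv.symm ⟨ℓ, hℓp⟩ with hv₀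
  -- unfold the pulled-back pairing
  change ctLevelPairing W (2 ^ L) e hμ hadd₁ hadd₂ hgal inv halt hPT' hH3
    (localTerm_finite_support (W := W) (m := 2 ^ L) (e := e) (hμ := hμ) (hadd₁ := hadd₁) (hadd₂ := hadd₂)
      (hgal := hgal) halt inv) (ι₁ ⟨_, hz⟩) (ι₁ ⟨t, ht⟩) ≠ 0
  -- the map `ι'` at level `2^L · 2^L`
  have hsha : ∀ c ∈ W.sha, ((2 : ℤ) ^ (2 * L)) • c = 0 → ((2 : ℤ) ^ L) • c = 0 :=
    sha_zsmul_eq_zero I hx (by omega) hL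
  have hL' : ∀ c ∈ W.sha, (((2 ^ L * 2 ^ L : ℕ) : ℤ)) • c = 0 → ((2 ^ L : ℕ) : ℤ) • c = 0 := by
    intro c hc h0
    rw [Nat.cast_pow, Nat.cast_ofNat]
    refine hsha c hc ?_
    rwa [Nat.cast_mul, Nat.cast_pow, Nat.cast_ofNat, ← pow_add, ← two_mul] at h0
  obtain ⟨ι', hι'⟩ := exists_selmerToShaTorsion W (2 ^ L) hL'
  -- transport to the level `2^L · 2^L`
  have hzτ : torsionH1OfDvd W (lvl_dvd_sq L) (((2 : ℤ) ^ j) • I.c₁ (ℓ * m')) ∈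
      selmerGroup W ((2 ^ L * 2 ^ L : ℕ) : ℤ) := torsionH1OfDvd_mem_selmerGroup W _ hz2
  have htτ : torsionH1OfDvd W (lvl_dvd_sq L) t ∈ selmerGroup W ((2 ^ L * 2 ^ L : ℕ) : ℤ) :=
    torsionH1OfDvd_mem_selmerGroup W _ ht2
  have hιz : ι₁ ⟨_, hz⟩ = ι' ⟨torsionH1OfDvd W (lvl_dvd_sq L) (((2 : ℤ) ^ j) • I.c₁ (ℓ * m')), hzτ⟩ :=
    Subtype.ext (Subtype.ext (by
      change shaTorsionVal W (2 ^ L) (ι₁ ⟨_, hz⟩) = shaTorsionVal W (2 ^ L) (ι' ⟨_, hzτ⟩)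
      rw [hι₁, hι', torsionH1ToH1_torsionH1OfDvd]
      rfl))
  have hιt : ι₁ ⟨t, ht⟩ = ι' ⟨torsionH1OfDvd W (lvl_dvd_sq L) t, htτ⟩ :=
    Subtype.ext (Subtype.ext (by
      change shaTorsionVal W (2 ^ L) (ι₁ ⟨t, ht⟩) = shaTorsionVal W (2 ^ L) (ι' ⟨_, htτ⟩)
      rw [hι₁, hι', torsionH1ToH1_torsionH1OfDvd]))
  rw [hιz, hιt]
  -- `z' = 2^L • b₁`
  have hz' : ((⟨torsionH1OfDvd W (lvl_dvd_sq L) (((2 : ℤ) ^ j) • I.c₁ (ℓ * m')), hzτ⟩ :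
      selmerGroup W ((2 ^ L * 2 ^ L : ℕ) : ℤ)) : galH1Torsion W ((2 ^ L * 2 ^ L : ℕ) : ℤ)) =
      ((2 ^ L : ℕ) : ℤ) • torsionH1OfDvd W (lvl_dvd_sq L) (((2 : ℤ) ^ (j - L)) • I.c₁ (ℓ * m')) := by
    change torsionH1OfDvd W (lvl_dvd_sq L) (((2 : ℤ) ^ j) • I.c₁ (ℓ * m')) = _
    rw [← map_zsmul, zsmul_pow_sub_eq hjL]
  -- first-case data: `[2^L]_* t' = 0` (`2^{2M₀} t = 0`, `2M₀ ≤ L`, `E(ℚ) ∩ E[2^L] = 0`)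
  have h2W := DokchitserDokchitser2012.forall_two_nsmul_of_hasSurjectiveModNGaloisRep_two W two_ne_zero hρ2
  have hfix : ∀ P : geomTorsion W ((2 ^ L : ℕ) : ℤ), (∀ σ : absoluteGaloisGroup ℚ, σ • P = P) → P = 0 :=
    geomTorsion_fixed_eq_zero_of_forall_two_nsmul W h2W L
  have h2L : ((2 ^ L : ℕ) : ℤ) • t = 0 := by
    have e1 : ((2 ^ L : ℕ) : ℤ) = (2 : ℤ) ^ (L - 2 * I.M₀) * (2 : ℤ) ^ (2 * I.M₀) := by
      rw [← pow_add, Nat.sub_add_cancel hL, Nat.cast_pow, Nat.cast_ofNat]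
    rw [e1, mul_smul, h22, zsmul_zero]
  have hmt : ((2 ^ L : ℕ) : ℤ) • torsionH1OfDvd W (lvl_dvd_sq L) t = 0 := by
    rw [← map_zsmul, h2L, map_zero]
  have hb₁ : ((2 ^ L : ℕ) : ℤ) • torsionH1OfDvd W (lvl_dvd_sq L) (((2 : ℤ) ^ (j - L)) • I.c₁ (ℓ * m')) ∈
      selmerGroup W ((2 ^ L * 2 ^ L : ℕ) : ℤ) := by
    rw [← map_zsmul, zsmul_pow_sub_eq hjL]; exact hzτ
  obtain ⟨D, hD₁, hDt⟩ := exists_firstCaseData_of_zsmul_of_map_mulK_eq_zero W (2 ^ L) hb₁ htτ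
    (map_mulK_eq_zero_of_zsmul_eq_zero W (2 ^ L) hfix hmt)
  rw [ctLevelPairing_pullback_ne_zero_iff_localTerm e hμ hadd₁ hadd₂ hgal inv halt hPT' hH3 _ ι' hι'
    ⟨_, hzτ⟩ ⟨_, htτ⟩ hz' D hD₁ hDt (Sum.inr v₀) ?_]
  · exact hloc₁ ℓ m' hℓ hsupp hndvd hodd j N a b t ht2 hz2 hN2 h22 hAq2 hj2 hNM2 hNj hab hcm2 hbt2 D hD₁ hDt
  -- ### the places `v ≠ v_ℓ`
  intro v hv
  rcases v with w | v'
  · -- an infinite place: Lemma 4.3 at `∞`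
    left
    have hc : I.c₁ (ℓ * m') ∈ selmerLocalKer W (Place.Completion (Sum.inl w : Place ℚ)) (lvl (L + L)) :=
      I.loc_c₁_inf (ℓ * m') hsupp heven w
    have hc' := (torsionH1OfDvd_mem_selmerLocalKer_iff W (Place.Completion (Sum.inl w : Place ℚ))
      (lvl_dvd_sq L) _).mp hc
    have key := mem_kummerLocalConditionAt_res_of_mem_selmerLocalKer W _ _ hc'
    rw [map_zsmul]
    convert AddSubgroup.zsmul_mem _ key ((2 : ℤ) ^ (j - L)) using 1
    exact map_zsmul _ _ _
  · by_cases hdiv : ((ℓ * m' : ℕ) : 𝓞 ℚ) ∈ v'.asIdeal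
    · -- a place of `ℓ m'` other than `v_ℓ`: a place `v_q`, `q ∣ m'`
      right
      have hm' : ((m' : ℕ) : 𝓞 ℚ) ∈ v'.asIdeal := by
        rcases natCast_mem_or_natCast_mem_of_mul_mem hdiv with h1 | h1
        · exact absurd ((natCast_prime_mem_iff_eq hℓp v').mp h1) (fun h ↦ hv (by rw [h]))
        · exact h1
      -- a prime factor `q` of `m'` with `q ∈ v'`
      obtain ⟨hsqm', hkolm'⟩ : KolSupp (kolPrime W K (L + L)) m' := by
        have hmem : ℓ ∈ (ℓ * m').primeFactors :=
          Nat.mem_primeFactors.mpr ⟨hℓp, dvd_mul_right ℓ m', hsupp.1.ne_zero⟩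
        obtain ⟨h, -⟩ := kolSupp_div hsupp hmem
        rwa [Nat.mul_div_cancel_left m' hℓp.pos] at h
      haveI := v'.isPrime
      have hprod : ((∏ q ∈ m'.primeFactors, q : ℕ) : 𝓞 ℚ) ∈ v'.asIdeal := by
        rwa [Nat.prod_primeFactors_of_squarefree hsqm']
      rw [Nat.cast_prod] at hprod
      obtain ⟨q, hq, hqv⟩ := Ideal.IsPrime.prod_mem_iff.mp hprod
      have hqp : q.Prime := Nat.prime_of_mem_primeFactors hq
      have hkq : kolPrime W K (L + L) q := hkolm' q hq
      have hv'eq : v' = primesEquiv.symm ⟨q, hqp⟩ := (natCast_prime_mem_iff_eq hqp v').mp hqv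
      subst hv'eq
      refine ⟨?_, map_inclKD_restrictField_injective_of_kolPrime hΔ hkq⟩
      -- `loc_q t' = 0`
      have htq : t ∈ W.torsionLocalKer ((primesEquiv.symm ⟨q, hqp⟩ : HeightOneSpectrum (𝓞 ℚ)).adicCompletion ℚ)
          (lvl (L + L)) := (mem_a₁_iff hqp t).mp (hAq2 q hq)
      have htq' := torsionH1OfDvd_mem_torsionLocalKer W
        (Place.Completion (Sum.inr (primesEquiv.symm ⟨q, hqp⟩) : Place ℚ)) (lvl_dvd_sq L) htq
      -- (`CharZero ℚ_q` passed explicitly: as an instance it would let `DivisionRing.toRatAlgebra` compete with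
      -- `Place.instAlgebraCompletion`)
      exact (@mem_torsionLocalKer_iff_res_eq_zero ℚ _ W
        (Place.Completion (Sum.inr (primesEquiv.symm ⟨q, hqp⟩) : Place ℚ)) _ (Place.instAlgebraCompletion _) _ _
        (charZero_placeCompletion _) (2 ^ L * 2 ^ L) (NeZero.ne (2 ^ L * 2 ^ L)) _).mp htq'
    · -- a finite place not dividing `ℓ m'`: Lemma 4.3 over `ℚ`
      left
      have hc : I.c₁ (ℓ * m') ∈ selmerLocalKer W (Place.Completion (Sum.inr v' : Place ℚ)) (lvl (L + L)) :=
        I.loc_c₁_fin (ℓ * m') hsupp heven v' hdiv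
      have hc' := (torsionH1OfDvd_mem_selmerLocalKer_iff W (Place.Completion (Sum.inr v' : Place ℚ))
        (lvl_dvd_sq L) _).mp hc
      have key := mem_kummerLocalConditionAt_res_of_mem_selmerLocalKer W _ _ hc'
      rw [map_zsmul]
      convert AddSubgroup.zsmul_mem _ key ((2 : ℤ) ^ (j - L)) using 1
      exact map_zsmul _ _ _

end MemberOne

end Summit.BirchSwinnertonDyer.BirchSwinnertonDyer.Theorems.GenusExact.VisiblePairAtTwo

end
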